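/-
Copyright (c) 2026 the pub-hodgecm-mathlib formalisation cell (harness21).  Prover seat hodgecm-mathlib-K2E1-p09 (g6), Track B ∕ K2-LIT, h413 =
`stmt-HodgeConjecture-24833`, ENGINE E1, campaign «EIS-R7-BL-SPH-2», deal «BL-P3» FILE B (part 1) of the dealer K2E1-plan (g5) («=» 2026-09-04T09:04:14Z: «type FILE B against
`hright : ∀ y, MeasurePreserving (rightShift y) μZ μZ` now»; RULING «Z := B(F)∖G(𝔸)» 08:57:54Z).
-/
import Summits.HodgeConjecture.HodgeConjecture.Theorems.K2E1BLBorelOperatorsU2Defs      -- ★ (K2E4-p10 g5): `borelQuotient`, `rightShift`, `borelQuotHeight`, `weightedTruncMeasure`, `HN`, `rightConvFun`, `ShiftBound`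
import Summits.HodgeConjecture.HodgeConjecture.Theorems.K2E1BLHeckeOperatorWeightedU2    -- ★ p858794 (this seat), FILE A: `exists_borelHeight_mul_le_of_isCompact` (function level)
import Summits.HodgeConjecture.HodgeConjecture.Theorems.K2E1BLIotaUnfoldingU              -- ★ (K2E1-p08 g6) P2a-ι part 1: `continuous_borelQuotHeight`, `measurable_borelQuotHeight`
import Literature.NumberTheory.Automorphic.UnitaryGroupTruncatedTraceClassElliptic        -- ★ `secondCountableTopology_quasiSplitAdelic`
import Mathlib.MeasureTheory.Integral.MeanInequalities                                    -- Mathlib `ENNReal.lintegral_mul_le_Lp_mul_Lq` (Hölder for `∫⁻`)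
import HarnessLib

/-!
# K2·E1 — `K2E1BLRightConvTonelliU2` («EIS-R7-BL-SPH-2», P3, FILE B part 1): THE `L²`-ESTIMATE FOR BERNSTEIN–LAPID'S `δ(h) = R(h)` ON `Z = B(F)∖G(𝔸)` AS A TONELLI
# COMPUTATION — `∫_{Z_{c₀}} HZ^{−2k}·‖R(h)f‖² dμZ ≤ κ^{2k}·‖h‖₁²·∫_{Z_{c₁}} HZ^{−2k}·‖f‖² dμZ`, AND THE NULL-SET TRANSFER ALONG `(z, y) ↦ z·y`

Track B ∕ K2-LIT, crux h413 = `stmt-HodgeConjecture-24833`, route of record `HCCMUnconditional`; cell `hodgecm-mathlib`, squad K2, ENGINE E1 (campaign «EIS-R7-BL», (ζ′) WIRING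
7d1cceb628a30de8 §3 P3, leaf of record ★ `K2E1BLBorelSpacesU2Defs` ∕ ★ `K2E1BLBorelOperatorsU2Defs`).  Prover seat `hodgecm-mathlib-K2E1-p09` (g6).  THEOREMS ONLY (no `def`, no
`instance` declarations, no notation, no named-fact hypothesis, no `sorry`; default heartbeats); lane `--supports stmt-HodgeConjecture-24833 --as helper` (count-neutral).  Closes no
socket.  RANK-GENERIC (`quasiSplit F E c N`).

THE MATHEMATICS [BernsteinLapid2019, §4 p. 10; MoeglinWaldspurger1995, I.2.13; Folland1999, Thm. 2.37, Thm. 6.18].  `Ω ⊆ G(𝔸)` compact, `κ = κ_Ω` of ★ FILE A (`H(x·y) ≤ κH(x)`,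
`H(x) ≤ κH(x·y)` on `Ω`), `h` measurable, integrable, `= 0` off `Ω`, `μZ` RIGHT-INVARIANT (LETTER `hright : ∀ y, MeasurePreserving (rightShift y) μZ μZ`, dealer 09:04:14Z; paid
by P2a-ι §4bis), `W = HZ^{−2k}`, `κc₁ ≤ c₀`, `f : Z → ℂ` measurable:
  `∫⁻_{Z_{c₀}} W·‖R(h)f‖ₑ² dμZ ≤ κ^{2k}‖h‖₁ ∫⁻_{Z_{c₀}}∫⁻_G ‖h(y)‖ₑ W(z·y)‖f(z·y)‖ₑ² dν dμZ` (Cauchy–Schwarz for `∫⁻` + `W(z) ≤ κ^{2k}W(z·y)` on `Ω`, §2–§3)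
  `= κ^{2k}‖h‖₁ ∫⁻_G ‖h(y)‖ₑ (∫⁻_{Z_{c₀}} (W‖f‖ₑ²)(z·y) dμZ) dν ≤ κ^{2k}‖h‖₁²·∫⁻_{Z_{c₁}} W‖f‖ₑ² dμZ` (TONELLI, §1 joint continuity of `(z,y) ↦ z·y`; `Z_{c₀}·y ⊆ Z_{c₁}` + `hright`, §4)
— the `𝓗_k(Z_{c₁}) → 𝓗_k(Z_{c₀})` bound of `ShiftBound` in `∫⁻` form.  §5 THE NULL-SET TRANSFER: a `μZ|_{Z_{c₁}}`-a.e. property holds at `z·y` for a.e. `z ∈ Z_{c₀}` and a.e.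
`y ∈ Ω` — so `R(h)` RESPECTS a.e.-EQUALITY and `y ↦ h(y)f(z·y)` is integrable for a.e. `z`: the two facts making `R(h)` LINEAR on `L²`-classes (FILE B part 2 `K2E1BLShiftBoundU2`).

* §1 `continuous_rightShift_uncurry`, `measurable_rightShift_uncurry` (`(z, y) ↦ z·y` on `Z × G(𝔸)`: `π × id` is an open quotient map; ★ `secondCountableTopology_quasiSplitAdelic`).
* §2 `lintegral_mul_sq_le` (Cauchy–Schwarz for `∫⁻`, from Mathlib's Hölder), `weight_le_mul_weight` (`W(z) ≤ κ^{2k}W(z·y)` on `Ω`, in `ℝ≥0∞`), `measurable_weight`,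
  `borelQuotHeight_pos`, `continuous_rightShift_left`, `measurable_rightShift_left` (★ `continuous_borelQuotHeight` of P2a-ι by name).
* §3 **`weight_mul_enorm_sq_rightConv_le`** (pointwise, `∫⁻` form).  §4 `setLIntegral_comp_rightShift_le` (`Z_{c₀}·y ⊆ Z_{c₁}` + `hright`), `measurable_integrand`,
  **`lintegral_weight_mul_enorm_sq_rightConv_le`** (THE BOUND).
* §5 **`ae_restrict_ae_comp_rightShift`** (null-set transfer), **`rightConvFun_congr_ae_restrict`**, `enorm_mul_le_add_sq`, **`ae_integrable_mul_comp_rightShift`**.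
HONEST LABEL: HC_CM is proved only modulo the 7 printed citations (2 remaining named inputs: hLiu418 = `stmt-HodgeConjecture-24832`, h413 = `stmt-HodgeConjecture-24833`) until rung 0
closes; this file asserts no named fact and closes no socket; count-neutral.

## References
* [BernsteinLapid2019] J. Bernstein, E. Lapid, *On the meromorphic continuation of Eisenstein series*, J. Amer. Math. Soc. 37 (2024) (arXiv:1911.02342): §4 p. 10.
* [MoeglinWaldspurger1995] C. Mœglin, J.-L. Waldspurger, *Spectral Decomposition and Eisenstein Series* (1995): I.2.13.
* [Folland1999] G. B. Folland, *Real Analysis* (2nd ed., 1999): Thm. 2.37 (Tonelli), Thm. 6.18 (integral operators on `L²`).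
-/

set_option autoImplicit false
set_option linter.dupNamespace false  -- the mandated namespace repeats the summit's segment (`HodgeConjecture.HodgeConjecture`)

noncomputable section

open MeasureTheory NumberField IsDedekindDomain Filter Topology Set
open scoped NNReal ENNReal
open Literature.NumberTheory.Automorphic Literature.NumberTheory.Automorphic.UnitaryGroup AdelicGroupData
open Summit.HodgeConjecture.HodgeConjecture.Cruxes.H413.K2E1BLBorelSpacesU2Defs
open Summit.HodgeConjecture.HodgeConjecture.Cruxes.H413.K2E1BLBorelOperatorsU2Defs
open Summit.HodgeConjecture.HodgeConjecture.Cruxes.H413.K2E1BLHeckeOperatorWeightedU2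
open Summit.HodgeConjecture.HodgeConjecture.Cruxes.H413.K2E1BLIotaUnfoldingU (continuous_borelQuotHeight measurable_borelQuotHeight)

namespace Summit.HodgeConjecture.HodgeConjecture.Cruxes.H413.K2E1BLRightConvTonelliU2

variable {F E : Type} [Field F] [NumberField F] [Field E] [NumberField E] [Algebra F E] {c : E ≃ₐ[F] E} {N : ℕ}

/-! ## §1 Joint continuity and measurability of `(z, y) ↦ z·y` on `Z × G(𝔸)` -/

/-- **`(z, y) ↦ z·y` IS JOINTLY CONTINUOUS on `Z × G(𝔸)`** (`π × id` is an open quotient map and `(g, y) ↦ π(g·y)` is continuous). [cite: BernsteinLapid2019, §4 p. 10] -/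
theorem continuous_rightShift_uncurry : Continuous fun p : borelQuotient F E c N × (quasiSplit F E c N).Adelic => rightShift F E c N p.2 p.1 := by
  have hopen : IsOpenMap (toBorelQuotient F E c N) := isOpenMap_quotient_mk'_mul
  have hq : IsQuotientMap (Prod.map (toBorelQuotient F E c N) (id : (quasiSplit F E c N).Adelic → (quasiSplit F E c N).Adelic)) :=
    (hopen.prodMap IsOpenMap.id).isQuotientMap ((continuous_toBorelQuotient F E c N).prodMap continuous_id)
      ((Quotient.mk_surjective).prodMap Function.surjective_id)
  refine hq.continuous_iff.2 ?_
  have heq : (fun p : borelQuotient F E c N × (quasiSplit F E c N).Adelic => rightShift F E c N p.2 p.1) ∘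
      Prod.map (toBorelQuotient F E c N) (id : (quasiSplit F E c N).Adelic → (quasiSplit F E c N).Adelic) =
      fun p : (quasiSplit F E c N).Adelic × (quasiSplit F E c N).Adelic => toBorelQuotient F E c N (p.1 * p.2) := by
    funext p; rfl
  rw [heq]
  exact (continuous_toBorelQuotient F E c N).comp (continuous_fst.mul continuous_snd)

variable [MeasurableSpace (quasiSplit F E c N).Adelic] [BorelSpace (quasiSplit F E c N).Adelic]

/-- **`(z, y) ↦ z·y` IS MEASURABLE** for the product of the Borel σ-algebras (the product σ-algebra contains the open sets since `G(𝔸)` is second countable). [folklore] -/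
theorem measurable_rightShift_uncurry : Measurable fun p : borelQuotient F E c N × (quasiSplit F E c N).Adelic => rightShift F E c N p.2 p.1 := by
  haveI := secondCountableTopology_quasiSplitAdelic (F := F) (E := E) (c := c) (N := N)
  exact (continuous_rightShift_uncurry (F := F) (E := E) (c := c) (N := N)).measurable

/-! ## §2 Cauchy–Schwarz for `∫⁻`, and the weight comparison in `ℝ≥0∞` -/

/-- **CAUCHY–SCHWARZ FOR `∫⁻`**: `(∫⁻ a·u)² ≤ (∫⁻ a)·(∫⁻ a·u²)` for a.e.-measurable `a, u : α → ℝ≥0∞` (Hölder `p = q = 2` for `a^{1∕2}` and `a^{1∕2}·u`). [cite: Folland1999, Thm. 6.18] -/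
theorem lintegral_mul_sq_le {α : Type*} [MeasurableSpace α] (ν : Measure α) {a u : α → ℝ≥0∞} (ha : AEMeasurable a ν) (hu : AEMeasurable u ν) :
    (∫⁻ y, a y * u y ∂ν) ^ 2 ≤ (∫⁻ y, a y ∂ν) * ∫⁻ y, a y * u y ^ 2 ∂ν := by
  have hpq : (2 : ℝ).HolderConjugate 2 := by
    rw [Real.holderConjugate_iff]; norm_num
  -- `a = s·s` with `s = a^{1/2}`
  set s : α → ℝ≥0∞ := fun y => a y ^ (1 / 2 : ℝ) with hs
  have hss : ∀ y, s y * s y = a y := fun y => by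
    rw [hs, ← ENNReal.rpow_add_of_nonneg _ _ (by norm_num) (by norm_num)]
    norm_num
  have hs2 : ∀ y, s y ^ (2 : ℝ) = a y := fun y => by
    rw [hs, ← ENNReal.rpow_mul]; norm_num
  have hsm : AEMeasurable s ν := ha.pow_const _
  have h := ENNReal.lintegral_mul_le_Lp_mul_Lq ν hpq hsm (hsm.mul hu)
  have hfg : (fun y => (s * (s * u)) y) = fun y => a y * u y := by
    funext y; simp only [Pi.mul_apply]; rw [← mul_assoc, hss]
  rw [hfg] at h
  have h1 : (fun y => s y ^ (2 : ℝ)) = a := funext hs2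
  have h2 : (fun y => (s * u) y ^ (2 : ℝ)) = fun y => a y * u y ^ 2 := by
    funext y
    rw [Pi.mul_apply, ENNReal.mul_rpow_of_nonneg _ _ (by norm_num : (0 : ℝ) ≤ 2), hs2, show (2 : ℝ) = ((2 : ℕ) : ℝ) by norm_num, ENNReal.rpow_natCast]
  simp only [h1, h2] at h
  -- square
  calc (∫⁻ y, a y * u y ∂ν) ^ 2 ≤ ((∫⁻ y, a y ∂ν) ^ (1 / (2 : ℝ)) * (∫⁻ y, a y * u y ^ 2 ∂ν) ^ (1 / (2 : ℝ))) ^ 2 := pow_le_pow_left₀ zero_le h 2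
    _ = (∫⁻ y, a y ∂ν) * ∫⁻ y, a y * u y ^ 2 ∂ν := by
        rw [mul_pow, ← ENNReal.rpow_natCast, ← ENNReal.rpow_natCast, ← ENNReal.rpow_mul, ← ENNReal.rpow_mul]
        norm_num

variable [NeZero N]

omit [MeasurableSpace (quasiSplit F E c N).Adelic] [BorelSpace (quasiSplit F E c N).Adelic] in
/-- **THE WEIGHT COMPARISON ON `Ω` IN `ℝ≥0∞`**: from `HZ(z·y) ≤ κ·HZ(z)`, `HZ(z)^{−2k} ≤ κ^{2k}·HZ(z·y)^{−2k}` (heights are positive). [cite: BernsteinLapid2019, §4 p. 10] -/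
theorem weight_le_mul_weight {κ : ℝ≥0} (k : ℕ) {z : borelQuotient F E c N} {y : (quasiSplit F E c N).Adelic}
    (hzy : borelQuotHeight F E c N (rightShift F E c N y z) ≤ κ * borelQuotHeight F E c N z) :
    ((((borelQuotHeight F E c N z)⁻¹ ^ (2 * k) : ℝ≥0)) : ℝ≥0∞) ≤
      ((κ ^ (2 * k) : ℝ≥0) : ℝ≥0∞) * (((borelQuotHeight F E c N (rightShift F E c N y z))⁻¹ ^ (2 * k) : ℝ≥0) : ℝ≥0∞) := by
  have hz0 : 0 < borelQuotHeight F E c N z := by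
    induction z using Quotient.inductionOn with
    | h g => exact borelHeight_pos g
  have hzy0 : 0 < borelQuotHeight F E c N (rightShift F E c N y z) := by
    induction z using Quotient.inductionOn with
    | h g => exact borelHeight_pos (g * y)
  have h1 : (borelQuotHeight F E c N z)⁻¹ ≤ κ * (borelQuotHeight F E c N (rightShift F E c N y z))⁻¹ := by
    rw [← div_eq_mul_inv, le_div_iff₀ hzy0, inv_mul_le_iff₀ hz0, mul_comm]
    exact hzy
  have h2 : (borelQuotHeight F E c N z)⁻¹ ^ (2 * k) ≤ κ ^ (2 * k) * (borelQuotHeight F E c N (rightShift F E c N y z))⁻¹ ^ (2 * k) := by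
    rw [← mul_pow]; exact pow_le_pow_left₀ zero_le h1 _
  exact_mod_cast h2

omit [MeasurableSpace (quasiSplit F E c N).Adelic] [BorelSpace (quasiSplit F E c N).Adelic] in
/-- The weight `z ↦ HZ(z)^{−2k}` (in `ℝ≥0∞`) is measurable. [cite: BernsteinLapid2019, §4 p. 10] -/
theorem measurable_weight (k : ℕ) : Measurable fun z : borelQuotient F E c N => ((((borelQuotHeight F E c N z)⁻¹ ^ (2 * k) : ℝ≥0)) : ℝ≥0∞) :=
  ((measurable_borelQuotHeight.inv).pow_const _).coe_nnreal_ennreal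

omit [MeasurableSpace (quasiSplit F E c N).Adelic] [BorelSpace (quasiSplit F E c N).Adelic] in
/-- `0 < HZ z`. [cite: BernsteinLapid2019, §4 p. 9] -/
theorem borelQuotHeight_pos (z : borelQuotient F E c N) : 0 < borelQuotHeight F E c N z := by
  induction z using Quotient.inductionOn with
  | h g => exact borelHeight_pos g

/-! ## §3 The pointwise estimate in `∫⁻` form (no integrability hypotheses) -/

variable (νG : Measure (quasiSplit F E c N).Adelic)

omit [MeasurableSpace (quasiSplit F E c N).Adelic] [BorelSpace (quasiSplit F E c N).Adelic] [NeZero N] in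
/-- `y ↦ z·y` is continuous for fixed `z` (`[g]·y = [g·y]`). [folklore] -/
theorem continuous_rightShift_left (z : borelQuotient F E c N) : Continuous fun y : (quasiSplit F E c N).Adelic => rightShift F E c N y z := by
  induction z using Quotient.inductionOn with
  | h g => exact (continuous_toBorelQuotient F E c N).comp (continuous_const_mul g)

omit [NeZero N] in
/-- `y ↦ z·y` is measurable for fixed `z`. [folklore] -/
theorem measurable_rightShift_left (z : borelQuotient F E c N) : Measurable fun y : (quasiSplit F E c N).Adelic => rightShift F E c N y z :=
  (continuous_rightShift_left z).measurable

/-- **THE POINTWISE `∫⁻` ESTIMATE**: for `κ` with `HZ(z·y) ≤ κ·HZ(z)` on `Ω`, `h` measurable and `= 0` off `Ω`, `f : Z → ℂ` measurable, and every `z`: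
`W(z)·‖(R(h)f)(z)‖ₑ² ≤ κ^{2k}·(∫⁻‖h‖ₑ)·∫⁻ ‖h(y)‖ₑ·(W(z·y)·‖f(z·y)‖ₑ²) dν` (`‖∫‖ₑ ≤ ∫⁻‖·‖ₑ`, Cauchy–Schwarz §2, weight comparison §2). [cite: BernsteinLapid2019, §4 p. 10] [cite: Folland1999, Thm. 6.18] -/
theorem weight_mul_enorm_sq_rightConv_le {Ω : Set (quasiSplit F E c N).Adelic} {κ : ℝ≥0}
    (hΩ : ∀ z : borelQuotient F E c N, ∀ y ∈ Ω, borelQuotHeight F E c N (rightShift F E c N y z) ≤ κ * borelQuotHeight F E c N z)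
    {h : (quasiSplit F E c N).Adelic → ℂ} (hhm : Measurable h) (hsupp : ∀ y, y ∉ Ω → h y = 0) (k : ℕ) {f : borelQuotient F E c N → ℂ} (hf : Measurable f) (z : borelQuotient F E c N) :
    ((((borelQuotHeight F E c N z)⁻¹ ^ (2 * k) : ℝ≥0)) : ℝ≥0∞) * ‖rightConvFun F E c N νG h f z‖ₑ ^ 2 ≤
      ((κ ^ (2 * k) : ℝ≥0) : ℝ≥0∞) * (∫⁻ y, ‖h y‖ₑ ∂νG) *
        ∫⁻ y, ‖h y‖ₑ * (((((borelQuotHeight F E c N (rightShift F E c N y z))⁻¹ ^ (2 * k) : ℝ≥0)) : ℝ≥0∞) * ‖f (rightShift F E c N y z)‖ₑ ^ 2) ∂νG := by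
  have hfz : Measurable fun y => f (rightShift F E c N y z) := hf.comp (measurable_rightShift_left z)
  have hwz : Measurable fun y => ((((borelQuotHeight F E c N (rightShift F E c N y z))⁻¹ ^ (2 * k) : ℝ≥0)) : ℝ≥0∞) :=
    (measurable_weight k).comp (measurable_rightShift_left z)
  -- `‖R(h)f(z)‖ₑ ≤ ∫⁻ ‖h‖ₑ‖f(z·)‖ₑ`
  have h1 : ‖rightConvFun F E c N νG h f z‖ₑ ≤ ∫⁻ y, ‖h y‖ₑ * ‖f (rightShift F E c N y z)‖ₑ ∂νG := by
    refine (enorm_integral_le_lintegral_enorm _).trans (le_of_eq (lintegral_congr fun y => ?_))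
    rw [enorm_mul]
  -- Cauchy–Schwarz
  have h2 : ‖rightConvFun F E c N νG h f z‖ₑ ^ 2 ≤ (∫⁻ y, ‖h y‖ₑ ∂νG) * ∫⁻ y, ‖h y‖ₑ * ‖f (rightShift F E c N y z)‖ₑ ^ 2 ∂νG :=
    (pow_le_pow_left₀ zero_le h1 2).trans (lintegral_mul_sq_le νG hhm.enorm.aemeasurable hfz.enorm.aemeasurable)
  -- the weight comparison, pointwise in `y` (off `Ω` both sides vanish)
  have h3 : ∀ y, ((((borelQuotHeight F E c N z)⁻¹ ^ (2 * k) : ℝ≥0)) : ℝ≥0∞) * (‖h y‖ₑ * ‖f (rightShift F E c N y z)‖ₑ ^ 2) ≤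
      ((κ ^ (2 * k) : ℝ≥0) : ℝ≥0∞) * (‖h y‖ₑ * (((((borelQuotHeight F E c N (rightShift F E c N y z))⁻¹ ^ (2 * k) : ℝ≥0)) : ℝ≥0∞) * ‖f (rightShift F E c N y z)‖ₑ ^ 2)) := by
    intro y
    by_cases hy : y ∈ Ω
    · calc _ ≤ (((κ ^ (2 * k) : ℝ≥0) : ℝ≥0∞) * ((((borelQuotHeight F E c N (rightShift F E c N y z))⁻¹ ^ (2 * k) : ℝ≥0)) : ℝ≥0∞)) * (‖h y‖ₑ * ‖f (rightShift F E c N y z)‖ₑ ^ 2) :=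
            mul_le_mul_left (weight_le_mul_weight k (hΩ z y hy)) _
        _ = _ := by ring
    · rw [hsupp y hy, enorm_zero, zero_mul, zero_mul, mul_zero, mul_zero]
  calc ((((borelQuotHeight F E c N z)⁻¹ ^ (2 * k) : ℝ≥0)) : ℝ≥0∞) * ‖rightConvFun F E c N νG h f z‖ₑ ^ 2
      ≤ ((((borelQuotHeight F E c N z)⁻¹ ^ (2 * k) : ℝ≥0)) : ℝ≥0∞) * ((∫⁻ y, ‖h y‖ₑ ∂νG) * ∫⁻ y, ‖h y‖ₑ * ‖f (rightShift F E c N y z)‖ₑ ^ 2 ∂νG) :=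
        mul_le_mul_right h2 _
    _ = (∫⁻ y, ‖h y‖ₑ ∂νG) * ∫⁻ y, ((((borelQuotHeight F E c N z)⁻¹ ^ (2 * k) : ℝ≥0)) : ℝ≥0∞) * (‖h y‖ₑ * ‖f (rightShift F E c N y z)‖ₑ ^ 2) ∂νG := by
        rw [lintegral_const_mul' _ _ ENNReal.coe_ne_top]; ring
    _ ≤ (∫⁻ y, ‖h y‖ₑ ∂νG) * ∫⁻ y, ((κ ^ (2 * k) : ℝ≥0) : ℝ≥0∞) * (‖h y‖ₑ * (((((borelQuotHeight F E c N (rightShift F E c N y z))⁻¹ ^ (2 * k) : ℝ≥0)) : ℝ≥0∞) * ‖f (rightShift F E c N y z)‖ₑ ^ 2)) ∂νG :=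
        mul_le_mul_right (lintegral_mono h3) _
    _ = ((κ ^ (2 * k) : ℝ≥0) : ℝ≥0∞) * (∫⁻ y, ‖h y‖ₑ ∂νG) *
          ∫⁻ y, ‖h y‖ₑ * (((((borelQuotHeight F E c N (rightShift F E c N y z))⁻¹ ^ (2 * k) : ℝ≥0)) : ℝ≥0∞) * ‖f (rightShift F E c N y z)‖ₑ ^ 2) ∂νG := by
        rw [lintegral_const_mul' _ _ ENNReal.coe_ne_top]; ring

/-! ## §4 Integration over `Z_{c₀}`: Tonelli, the support clause `Z_{c₀}·y ⊆ Z_{c₁}`, and right-invariance -/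

variable (μZ : Measure (borelQuotient F E c N))

omit [MeasurableSpace (quasiSplit F E c N).Adelic] [BorelSpace (quasiSplit F E c N).Adelic] in
/-- **`Z_{c₀}·y ⊆ Z_{c₁}` AND RIGHT-INVARIANCE**: if `HZ(z) ≤ κ·HZ(z·y)` for all `z` (`κ > 0`), `κ·c₁ ≤ c₀`, `μZ` is preserved by `rightShift y`, and `Φ ≥ 0` is measurable, then
`∫⁻_{Z_{c₀}} Φ(z·y) dμZ ≤ ∫⁻_{Z_{c₁}} Φ dμZ`. [cite: BernsteinLapid2019, §4 p. 10] -/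
theorem setLIntegral_comp_rightShift_le (hright : ∀ y, MeasurePreserving (rightShift F E c N y) μZ μZ) {κ c₁ c₀ : ℝ≥0} (hκ : 0 < κ) (hc : κ * c₁ ≤ c₀)
    {y : (quasiSplit F E c N).Adelic} (hy : ∀ z, borelQuotHeight F E c N z ≤ κ * borelQuotHeight F E c N (rightShift F E c N y z)) {Φ : borelQuotient F E c N → ℝ≥0∞}
    (hΦ : Measurable Φ) :
    ∫⁻ z in {z | c₀ < borelQuotHeight F E c N z}, Φ (rightShift F E c N y z) ∂μZ ≤ ∫⁻ z in {z | c₁ < borelQuotHeight F E c N z}, Φ z ∂μZ := by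
  rw [← lintegral_indicator (measurableSet_lt measurable_const measurable_borelQuotHeight), ← lintegral_indicator (measurableSet_lt measurable_const measurable_borelQuotHeight),
    ← (hright y).lintegral_comp ((hΦ.indicator (measurableSet_lt measurable_const measurable_borelQuotHeight)))]
  refine lintegral_mono fun z => ?_
  by_cases hz : c₀ < borelQuotHeight F E c N z
  · have hzy : c₁ < borelQuotHeight F E c N (rightShift F E c N y z) :=
      lt_of_mul_lt_mul_left ((hc.trans_lt hz).trans_le (hy z)) hκ.le
    rw [indicator_of_mem (show z ∈ {z | c₀ < borelQuotHeight F E c N z} from hz),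
      indicator_of_mem (show rightShift F E c N y z ∈ {z | c₁ < borelQuotHeight F E c N z} from hzy)]
  · rw [indicator_of_notMem (show z ∉ {z | c₀ < borelQuotHeight F E c N z} from hz)]
    exact zero_le

/-- The two-variable integrand `(z, y) ↦ ‖h y‖ₑ·W(z·y)·‖f(z·y)‖ₑ²` is measurable on `Z × G(𝔸)`. [folklore] -/
theorem measurable_integrand {h : (quasiSplit F E c N).Adelic → ℂ} (hhm : Measurable h) (k : ℕ) {f : borelQuotient F E c N → ℂ} (hf : Measurable f) :
    Measurable fun p : borelQuotient F E c N × (quasiSplit F E c N).Adelic =>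
      ‖h p.2‖ₑ * (((((borelQuotHeight F E c N (rightShift F E c N p.2 p.1))⁻¹ ^ (2 * k) : ℝ≥0)) : ℝ≥0∞) * ‖f (rightShift F E c N p.2 p.1)‖ₑ ^ 2) :=
  (hhm.comp measurable_snd).enorm.mul (((measurable_weight k).comp measurable_rightShift_uncurry).mul ((hf.comp measurable_rightShift_uncurry).enorm.pow_const 2))

/-- **THE `L²`-BOUND IN `∫⁻` FORM**: under the letters of §3–§4 (`κ > 0`, `κ·c₁ ≤ c₀`, two-sided height comparison on `Ω`, `hright`, `h` measurable with `∫⁻‖h‖ₑ < ∞` and `= 0` off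
`Ω`, `f` measurable),
`∫⁻_{Z_{c₀}} W·‖R(h)f‖ₑ² dμZ ≤ κ^{2k}·(∫⁻‖h‖ₑ)²·∫⁻_{Z_{c₁}} W·‖f‖ₑ² dμZ` — i.e. `‖R(h)f‖_{𝓗_k(Z_{c₀})} ≤ κ^k‖h‖₁·‖f‖_{𝓗_k(Z_{c₁})}` (Tonelli on `Z_{c₀} × G(𝔸)`).
[cite: BernsteinLapid2019, §4 p. 10] [cite: MoeglinWaldspurger1995, I.2.13] [cite: Folland1999, Thm. 2.37] -/
theorem lintegral_weight_mul_enorm_sq_rightConv_le [SFinite νG] [SFinite μZ] (hright : ∀ y, MeasurePreserving (rightShift F E c N y) μZ μZ)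
    {Ω : Set (quasiSplit F E c N).Adelic} {κ c₁ c₀ : ℝ≥0} (hκ : 0 < κ) (hc : κ * c₁ ≤ c₀)
    (hΩ : ∀ z : borelQuotient F E c N, ∀ y ∈ Ω,
      borelQuotHeight F E c N (rightShift F E c N y z) ≤ κ * borelQuotHeight F E c N z ∧ borelQuotHeight F E c N z ≤ κ * borelQuotHeight F E c N (rightShift F E c N y z))
    {h : (quasiSplit F E c N).Adelic → ℂ} (hhm : Measurable h) (hh1 : ∫⁻ y, ‖h y‖ₑ ∂νG ≠ ∞) (hsupp : ∀ y, y ∉ Ω → h y = 0) (k : ℕ)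
    {f : borelQuotient F E c N → ℂ} (hf : Measurable f) :
    ∫⁻ z in {z | c₀ < borelQuotHeight F E c N z}, ((((borelQuotHeight F E c N z)⁻¹ ^ (2 * k) : ℝ≥0)) : ℝ≥0∞) * ‖rightConvFun F E c N νG h f z‖ₑ ^ 2 ∂μZ ≤
      ((κ ^ (2 * k) : ℝ≥0) : ℝ≥0∞) * (∫⁻ y, ‖h y‖ₑ ∂νG) ^ 2 *
        ∫⁻ z in {z | c₁ < borelQuotHeight F E c N z}, ((((borelQuotHeight F E c N z)⁻¹ ^ (2 * k) : ℝ≥0)) : ℝ≥0∞) * ‖f z‖ₑ ^ 2 ∂μZ := by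
  set A := ∫⁻ y, ‖h y‖ₑ ∂νG with hA
  set C := ∫⁻ z in {z | c₁ < borelQuotHeight F E c N z}, ((((borelQuotHeight F E c N z)⁻¹ ^ (2 * k) : ℝ≥0)) : ℝ≥0∞) * ‖f z‖ₑ ^ 2 ∂μZ with hC
  have hI := measurable_integrand hhm k hf
  -- step 1: pointwise (§3) and pull the constant
  have h1 : ∫⁻ z in {z | c₀ < borelQuotHeight F E c N z}, ((((borelQuotHeight F E c N z)⁻¹ ^ (2 * k) : ℝ≥0)) : ℝ≥0∞) * ‖rightConvFun F E c N νG h f z‖ₑ ^ 2 ∂μZ ≤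
      ((κ ^ (2 * k) : ℝ≥0) : ℝ≥0∞) * A * ∫⁻ z in {z | c₀ < borelQuotHeight F E c N z},
        ∫⁻ y, ‖h y‖ₑ * (((((borelQuotHeight F E c N (rightShift F E c N y z))⁻¹ ^ (2 * k) : ℝ≥0)) : ℝ≥0∞) * ‖f (rightShift F E c N y z)‖ₑ ^ 2) ∂νG ∂μZ := by
    rw [← lintegral_const_mul' _ _ (ENNReal.mul_ne_top ENNReal.coe_ne_top hh1)]
    exact lintegral_mono fun z => weight_mul_enorm_sq_rightConv_le νG (fun z y hy => (hΩ z y hy).1) hhm hsupp k hf z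
  -- step 2: Tonelli
  have h2 : ∫⁻ z in {z | c₀ < borelQuotHeight F E c N z},
        ∫⁻ y, ‖h y‖ₑ * (((((borelQuotHeight F E c N (rightShift F E c N y z))⁻¹ ^ (2 * k) : ℝ≥0)) : ℝ≥0∞) * ‖f (rightShift F E c N y z)‖ₑ ^ 2) ∂νG ∂μZ =
      ∫⁻ y, ∫⁻ z in {z | c₀ < borelQuotHeight F E c N z},
        ‖h y‖ₑ * (((((borelQuotHeight F E c N (rightShift F E c N y z))⁻¹ ^ (2 * k) : ℝ≥0)) : ℝ≥0∞) * ‖f (rightShift F E c N y z)‖ₑ ^ 2) ∂μZ ∂νG :=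
    lintegral_lintegral_swap hI.aemeasurable
  -- step 3: the inner bound per `y`
  have h3 : ∀ y, ∫⁻ z in {z | c₀ < borelQuotHeight F E c N z},
        ‖h y‖ₑ * (((((borelQuotHeight F E c N (rightShift F E c N y z))⁻¹ ^ (2 * k) : ℝ≥0)) : ℝ≥0∞) * ‖f (rightShift F E c N y z)‖ₑ ^ 2) ∂μZ ≤ ‖h y‖ₑ * C := by
    intro y
    rw [lintegral_const_mul' _ _ enorm_ne_top]
    by_cases hy : y ∈ Ω
    · exact mul_le_mul_right (setLIntegral_comp_rightShift_le μZ hright hκ hc (fun z => (hΩ z y hy).2)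
        (Φ := fun z => ((((borelQuotHeight F E c N z)⁻¹ ^ (2 * k) : ℝ≥0)) : ℝ≥0∞) * ‖f z‖ₑ ^ 2) ((measurable_weight k).mul (hf.enorm.pow_const 2))) _
    · rw [hsupp y hy, enorm_zero, zero_mul, zero_mul]
  -- step 4: assemble
  calc _ ≤ ((κ ^ (2 * k) : ℝ≥0) : ℝ≥0∞) * A * ∫⁻ y, ∫⁻ z in {z | c₀ < borelQuotHeight F E c N z},
          ‖h y‖ₑ * (((((borelQuotHeight F E c N (rightShift F E c N y z))⁻¹ ^ (2 * k) : ℝ≥0)) : ℝ≥0∞) * ‖f (rightShift F E c N y z)‖ₑ ^ 2) ∂μZ ∂νG := by rw [← h2]; exact h1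
    _ ≤ ((κ ^ (2 * k) : ℝ≥0) : ℝ≥0∞) * A * ∫⁻ y, ‖h y‖ₑ * C ∂νG := mul_le_mul_right (lintegral_mono h3) _
    _ = ((κ ^ (2 * k) : ℝ≥0) : ℝ≥0∞) * A ^ 2 * C := by rw [lintegral_mul_const _ hhm.enorm, hA]; ring

/-! ## §5 The null-set transfer along `(z, y) ↦ z·y`, a.e.-congruence of `R(h)`, a.e. integrability -/

/-- **THE NULL-SET TRANSFER**: if `p` holds `μZ`-a.e. on `Z_{c₁}`, then for `μZ`-a.e. `z ∈ Z_{c₀}` it holds at `z·y` for `νG`-a.e. `y ∈ Ω` (`{(z, y) : y ∈ Ω, z·y ∈ T}`, `T ⊇ {¬p}`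
a `μZ|_{Z_{c₁}}`-null measurable set, is `μZ|_{Z_{c₀}} ⊗ νG`-null by Tonelli: each `y`-slice lies in `rightShift y⁻¹ T`). [cite: Folland1999, Thm. 2.37] -/
theorem ae_restrict_ae_comp_rightShift [SFinite νG] [SFinite μZ] (hright : ∀ y, MeasurePreserving (rightShift F E c N y) μZ μZ) {Ω : Set (quasiSplit F E c N).Adelic}
    (hΩm : MeasurableSet Ω) {κ c₁ c₀ : ℝ≥0} (hκ : 0 < κ) (hc : κ * c₁ ≤ c₀)
    (hΩ : ∀ z : borelQuotient F E c N, ∀ y ∈ Ω, borelQuotHeight F E c N z ≤ κ * borelQuotHeight F E c N (rightShift F E c N y z))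
    {p : borelQuotient F E c N → Prop} (hp : ∀ᵐ z ∂(μZ.restrict {z | c₁ < borelQuotHeight F E c N z}), p z) :
    ∀ᵐ z ∂(μZ.restrict {z | c₀ < borelQuotHeight F E c N z}), ∀ᵐ y ∂νG, y ∈ Ω → p (rightShift F E c N y z) := by
  -- a measurable null superset `T` of the exceptional set inside `Z_{c₁}`
  have hnull : μZ ({z | ¬p z} ∩ {z | c₁ < borelQuotHeight F E c N z}) = 0 := by
    rw [← Measure.restrict_apply' (measurableSet_lt measurable_const measurable_borelQuotHeight)]; exact ae_iff.1 hp
  obtain ⟨T, hTsub, hTm, hT0⟩ := exists_measurable_superset_of_null hnull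
  -- the exceptional set in the product
  set A : Set (borelQuotient F E c N × (quasiSplit F E c N).Adelic) := {q | q.2 ∈ Ω ∧ rightShift F E c N q.2 q.1 ∈ T} with hAdef
  have hAm : MeasurableSet A := (hΩm.preimage measurable_snd).inter (hTm.preimage measurable_rightShift_uncurry)
  have hA0 : ((μZ.restrict {z | c₀ < borelQuotHeight F E c N z}).prod νG) A = 0 := by
    rw [Measure.prod_apply_symm hAm]
    refine (lintegral_congr fun y => ?_).trans lintegral_zero
    change (μZ.restrict {z | c₀ < borelQuotHeight F E c N z}) ((fun z => (z, y)) ⁻¹' A) = 0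
    by_cases hy : y ∈ Ω
    · have hsub : (fun z : borelQuotient F E c N => (z, y)) ⁻¹' A ⊆ rightShift F E c N y ⁻¹' T := fun z hz => hz.2
      refine le_antisymm ((Measure.restrict_le_self _).trans ((measure_mono hsub).trans (le_of_eq ?_))) zero_le
      rw [(hright y).measure_preimage hTm.nullMeasurableSet, hT0]
    · have hempty : (fun z : borelQuotient F E c N => (z, y)) ⁻¹' A = ∅ := Set.eq_empty_of_forall_notMem fun z hz => hy hz.1
      rw [hempty, measure_empty]
  have hae : ∀ᵐ q ∂((μZ.restrict {z | c₀ < borelQuotHeight F E c N z}).prod νG), q ∉ A :=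
    ae_iff.2 (by simpa only [not_not, Set.setOf_mem_eq] using hA0)
  filter_upwards [Measure.ae_ae_of_ae_prod hae, ae_restrict_mem (measurableSet_lt measurable_const measurable_borelQuotHeight)] with z hz hz0 
  filter_upwards [hz] with y hy hyΩ
  have hzy : c₁ < borelQuotHeight F E c N (rightShift F E c N y z) := lt_of_mul_lt_mul_left ((hc.trans_lt hz0).trans_le (hΩ z y hyΩ)) hκ.le
  by_contra hpy
  exact hy ⟨hyΩ, hTsub ⟨hpy, hzy⟩⟩

/-- **`R(h)` RESPECTS a.e.-EQUALITY** (no integrability needed): `f₁ = f₂` `μZ`-a.e. on `Z_{c₁}` ⟹ `R(h)f₁ = R(h)f₂` `μZ`-a.e. on `Z_{c₀}` (the integrands `h(y)fᵢ(z·y)` agree for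
a.e. `y`, since `h = 0` off `Ω`). [cite: BernsteinLapid2019, §4 p. 10] -/
theorem rightConvFun_congr_ae_restrict [SFinite νG] [SFinite μZ] (hright : ∀ y, MeasurePreserving (rightShift F E c N y) μZ μZ) {Ω : Set (quasiSplit F E c N).Adelic}
    (hΩm : MeasurableSet Ω) {κ c₁ c₀ : ℝ≥0} (hκ : 0 < κ) (hc : κ * c₁ ≤ c₀)
    (hΩ : ∀ z : borelQuotient F E c N, ∀ y ∈ Ω, borelQuotHeight F E c N z ≤ κ * borelQuotHeight F E c N (rightShift F E c N y z))
    {h : (quasiSplit F E c N).Adelic → ℂ} (hsupp : ∀ y, y ∉ Ω → h y = 0) {f₁ f₂ : borelQuotient F E c N → ℂ}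
    (h12 : f₁ =ᵐ[μZ.restrict {z | c₁ < borelQuotHeight F E c N z}] f₂) :
    rightConvFun F E c N νG h f₁ =ᵐ[μZ.restrict {z | c₀ < borelQuotHeight F E c N z}] rightConvFun F E c N νG h f₂ := by
  filter_upwards [ae_restrict_ae_comp_rightShift νG μZ hright hΩm hκ hc hΩ (p := fun z => f₁ z = f₂ z) h12] with z hz
  refine integral_congr_ae ?_
  filter_upwards [hz] with y hy
  by_cases hyΩ : y ∈ Ω
  · rw [hy hyΩ]
  · rw [hsupp y hyΩ, zero_mul, zero_mul]

omit [BorelSpace (quasiSplit F E c N).Adelic] in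
/-- `‖a‖ₑ·‖b‖ₑ ≤ ‖a‖ₑ + ‖a‖ₑ·‖b‖ₑ²` (`t ≤ 1 + t²` in `ℝ≥0∞`). [folklore] -/
theorem enorm_mul_le_add_sq (a b : ℂ) : ‖a‖ₑ * ‖b‖ₑ ≤ ‖a‖ₑ + ‖a‖ₑ * ‖b‖ₑ ^ 2 := by
  rcases le_total ‖b‖ₑ 1 with hb | hb
  · exact (mul_le_mul_right hb _).trans (by rw [mul_one]; exact le_self_add)
  · exact (mul_le_mul_right (by rw [sq]; exact le_mul_of_one_le_left zero_le hb) _).trans le_add_self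

/-- **a.e. INTEGRABILITY OF THE CONVOLUTION INTEGRAND**: `h` measurable, integrable, `= 0` off `Ω`, `f` measurable with `∫⁻_{Z_{c₁}} W‖f‖ₑ² dμZ < ∞` ⟹ for `μZ`-a.e. `z ∈ Z_{c₀}`,
`y ↦ h(y)·f(z·y)` is `νG`-integrable (Tonelli's finiteness + `W(z) ≤ κ^{2k}W(z·y)` on `Ω` + `ab ≤ a + ab²`). [cite: Folland1999, Thm. 2.37] -/
theorem ae_integrable_mul_comp_rightShift [SFinite νG] [SFinite μZ] (hright : ∀ y, MeasurePreserving (rightShift F E c N y) μZ μZ)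
    {Ω : Set (quasiSplit F E c N).Adelic} {κ c₁ c₀ : ℝ≥0} (hκ : 0 < κ) (hc : κ * c₁ ≤ c₀)
    (hΩ : ∀ z : borelQuotient F E c N, ∀ y ∈ Ω,
      borelQuotHeight F E c N (rightShift F E c N y z) ≤ κ * borelQuotHeight F E c N z ∧ borelQuotHeight F E c N z ≤ κ * borelQuotHeight F E c N (rightShift F E c N y z))
    {h : (quasiSplit F E c N).Adelic → ℂ} (hhm : Measurable h) (hh : Integrable h νG) (hsupp : ∀ y, y ∉ Ω → h y = 0) (k : ℕ) {f : borelQuotient F E c N → ℂ}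
    (hf : Measurable f) (hfin : ∫⁻ z in {z | c₁ < borelQuotHeight F E c N z}, ((((borelQuotHeight F E c N z)⁻¹ ^ (2 * k) : ℝ≥0)) : ℝ≥0∞) * ‖f z‖ₑ ^ 2 ∂μZ ≠ ∞) :
    ∀ᵐ z ∂(μZ.restrict {z | c₀ < borelQuotHeight F E c N z}), Integrable (fun y => h y * f (rightShift F E c N y z)) νG := by
  have hI := measurable_integrand hhm k hf
  have hA : ∫⁻ y, ‖h y‖ₑ ∂νG ≠ ∞ := hh.2.ne
  -- Tonelli's finiteness: the iterated integral is finite (steps 2–4 of §4 with the roles as there)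
  have hfinite : ∫⁻ z in {z | c₀ < borelQuotHeight F E c N z},
      ∫⁻ y, ‖h y‖ₑ * (((((borelQuotHeight F E c N (rightShift F E c N y z))⁻¹ ^ (2 * k) : ℝ≥0)) : ℝ≥0∞) * ‖f (rightShift F E c N y z)‖ₑ ^ 2) ∂νG ∂μZ ≠ ∞ := by
    rw [lintegral_lintegral_swap hI.aemeasurable]
    have h3 : ∀ y, ∫⁻ z in {z | c₀ < borelQuotHeight F E c N z},
        ‖h y‖ₑ * (((((borelQuotHeight F E c N (rightShift F E c N y z))⁻¹ ^ (2 * k) : ℝ≥0)) : ℝ≥0∞) * ‖f (rightShift F E c N y z)‖ₑ ^ 2) ∂μZ ≤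
        ‖h y‖ₑ * ∫⁻ z in {z | c₁ < borelQuotHeight F E c N z}, ((((borelQuotHeight F E c N z)⁻¹ ^ (2 * k) : ℝ≥0)) : ℝ≥0∞) * ‖f z‖ₑ ^ 2 ∂μZ := by
      intro y
      rw [lintegral_const_mul' _ _ enorm_ne_top]
      by_cases hy : y ∈ Ω
      · exact mul_le_mul_right (setLIntegral_comp_rightShift_le μZ hright hκ hc (fun z => (hΩ z y hy).2)
          (Φ := fun z => ((((borelQuotHeight F E c N z)⁻¹ ^ (2 * k) : ℝ≥0)) : ℝ≥0∞) * ‖f z‖ₑ ^ 2) ((measurable_weight k).mul (hf.enorm.pow_const 2))) _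
      · rw [hsupp y hy, enorm_zero, zero_mul, zero_mul]
    refine ne_top_of_le_ne_top ?_ (lintegral_mono h3)
    rw [lintegral_mul_const _ hhm.enorm]
    exact ENNReal.mul_ne_top hA hfin
  -- hence the inner integral is finite for a.e. `z`
  have hae := ae_lt_top (hI.lintegral_prod_right') hfinite
  filter_upwards [hae, ae_restrict_mem (measurableSet_lt measurable_const measurable_borelQuotHeight)] with z hz hz0
  have hfz : Measurable fun y => f (rightShift F E c N y z) := hf.comp (measurable_rightShift_left z)
  -- `W(z) ≤ κ^{2k} W(z·y)` on `Ω` gives `∫⁻ ‖h‖ₑ‖f(z·)‖ₑ² < ∞`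
  have hWz : ((((borelQuotHeight F E c N z)⁻¹ ^ (2 * k) : ℝ≥0)) : ℝ≥0∞) ≠ 0 := by
    exact_mod_cast (pow_pos (inv_pos.2 (borelQuotHeight_pos z)) _).ne'
  have hsq : ∫⁻ y, ‖h y‖ₑ * ‖f (rightShift F E c N y z)‖ₑ ^ 2 ∂νG < ∞ := by
    have hle : ∀ y, ((((borelQuotHeight F E c N z)⁻¹ ^ (2 * k) : ℝ≥0)) : ℝ≥0∞) * (‖h y‖ₑ * ‖f (rightShift F E c N y z)‖ₑ ^ 2) ≤
        ((κ ^ (2 * k) : ℝ≥0) : ℝ≥0∞) * (‖h y‖ₑ * (((((borelQuotHeight F E c N (rightShift F E c N y z))⁻¹ ^ (2 * k) : ℝ≥0)) : ℝ≥0∞) * ‖f (rightShift F E c N y z)‖ₑ ^ 2)) := by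
      intro y
      by_cases hy : y ∈ Ω
      · calc _ ≤ (((κ ^ (2 * k) : ℝ≥0) : ℝ≥0∞) * ((((borelQuotHeight F E c N (rightShift F E c N y z))⁻¹ ^ (2 * k) : ℝ≥0)) : ℝ≥0∞)) * (‖h y‖ₑ * ‖f (rightShift F E c N y z)‖ₑ ^ 2) :=
              mul_le_mul_left (weight_le_mul_weight k (hΩ z y hy).1) _
          _ = _ := by ring
      · rw [hsupp y hy, enorm_zero, zero_mul, zero_mul, mul_zero, mul_zero]
    have hbound : ((((borelQuotHeight F E c N z)⁻¹ ^ (2 * k) : ℝ≥0)) : ℝ≥0∞) * ∫⁻ y, ‖h y‖ₑ * ‖f (rightShift F E c N y z)‖ₑ ^ 2 ∂νG < ∞ := by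
      rw [← lintegral_const_mul' _ _ ENNReal.coe_ne_top]
      refine lt_of_le_of_lt (lintegral_mono hle) ?_
      rw [lintegral_const_mul' _ _ ENNReal.coe_ne_top]
      exact ENNReal.mul_lt_top ENNReal.coe_lt_top hz
    exact (ENNReal.mul_lt_top_iff.1 hbound).elim (fun h' => h'.2) fun h' => h'.elim (fun h0 => (hWz h0).elim) fun hb0 => by rw [hb0]; exact ENNReal.zero_lt_top
  refine ⟨(hhm.mul hfz).aestronglyMeasurable, ?_⟩
  refine lt_of_le_of_lt (lintegral_mono fun y => ?_) (show ∫⁻ y, ‖h y‖ₑ + ‖h y‖ₑ * ‖f (rightShift F E c N y z)‖ₑ ^ 2 ∂νG < ∞ from ?_)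
  · rw [enorm_mul]; exact enorm_mul_le_add_sq _ _
  · rw [lintegral_add_left hhm.enorm]
    exact ENNReal.add_lt_top.2 ⟨hh.2, hsq⟩

end Summit.HodgeConjecture.HodgeConjecture.Cruxes.H413.K2E1BLRightConvTonelliU2

end
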